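import Literature.NumberTheory.Automorphic.WeightOneOrdinaryLiftGaloisProofs
import Literature.NumberTheory.EllipticCurves.WeightOneOrdinaryLiftRamifiedProofs
import HarnessLib

/-!
# A `p`-ordinary newform lift of weight `≥ 2` of the residual representation of a `p`-ordinary
# weight-one newform of level divisible by `p` (ramified case of Wiles 1988, Thm. 3, in
# Allen 2014, Lemma 87; proofs only)

Topic `Literature/NumberTheory/Automorphic`; namespace `Literature.NumberTheory.Automorphic`.
THEOREMS ONLY (no definition, no named fact; D-0026).  The companion of
`exists_ordinary_newform_lift_of_weightOne_of_isUnramifiedAt` (`WeightOneOrdinaryLiftGaloisProofs`)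
for a weight-one newform `f₁` of level `N₁` DIVISIBLE by `p` which is `p`-ordinary through
`ι₁ : K_{f₁} → ℚ̄_p` (`|ι₁ a_p(f₁)|_p = 1`; by Deligne–Serre Thm. 4.6 (b) this is the case exactly
when `ρ_{f₁}|_{Γ_{ℚ_p}}` has a one-dimensional unramified quotient,
`WeightOneEigenvalueOfSplitLocalProofs`): granted the existing named fact
`Hida2000_thm326_exists_galoisRep`, there is a `p`-ordinary newform `g` of weight `≥ 2` with a
`p`-adic representation `ρ_g` whose residual representation is the given irreducible reduction
`τ` of `ρ₁ = ρ_{f₁}`.  Proof: `exists_ordinary_newform_congr_of_weight_one_of_dvd_level`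
(Deligne–Serre 6.9–6.11 with `U_p` in the family, no stabilisation), then Step 4 of the
unramified case verbatim (Deligne's `ρ_g` through `ι⁻¹`, congruent Frobenius polynomials away from
`N₁ L₀ p`, Chebotarev + Brauer–Nesbitt `FramedGaloisRep.isResidualRepOf_of_isResidualRepOf_of_congruent`).

## References

* P. B. Allen, Compos. Math. 150 (2014), Lemma 87 (arXiv:1301.1113v2, §5.1.1, p. 70). [Allen2014]
* A. Wiles, Invent. Math. 94 (1988), 529–573, §1 and Thm. 3. [Wiles1988]
* P. Deligne, J.-P. Serre, Ann. Sci. ÉNS (4) 7 (1974), 6.9–6.11, §8, Thm. 4.6. [DeligneSerreASENS1974]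
* H. Hida, *Modular Forms and Galois Cohomology* (2000), Thm. 3.26 (1). [Hida2000]
-/

noncomputable section

open scoped MatrixGroups ModularForm NumberField Polynomial

open CongruenceSubgroup Polynomial IsDedekindDomain IsLocalRing Field
  Rat.HeightOneSpectrum Literature.NumberTheory.GaloisRepresentations
  Literature.NumberTheory.EllipticCurves Literature.NumberTheory.EllipticCurves.ModularForms
  Literature.NumberTheory.EllipticCurves.ModularForms.DeligneSerre1974

namespace Literature.NumberTheory.Automorphic

section Main

variable {p : ℕ} [Fact p.Prime]

set_option maxHeartbeats 1600000 in
/-- **A `p`-ordinary newform lift of weight `≥ 2` of the residual representation of a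
`p`-ORDINARY weight-one newform of level divisible by `p`** (the ramified case of the input
`[WilesOrdinary, Theorem 3]` of Allen 2014, Lemma 87, proved classically: Deligne–Serre 6.9–6.11
with `U_p` in the Hecke family and no stabilisation, `exists_ordinary_newform_congr_of_weight_one_of_dvd_level`;
Atkin–Lehner–Li at any `p`-power level; Chebotarev and Brauer–Nesbitt), granted Deligne's `p`-adic
representation of the lifted newform through the prescribed embedding
(`Hida2000_thm326_exists_galoisRep`).  Hypotheses: `p ∣ N₁` and `|ι₁ a_p(f₁)|_p = 1` (for the
representation-theoretic source of the latter see `norm_cuspCoeff_eq_one_of_toLocal_diagonal`,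
`WeightOneEigenvalueOfSplitLocalProofs`).
[cite: Allen2014, Lemma 87 (arXiv:1301.1113v2, §5.1.1, p. 70)] [cite: Wiles1988, §1 and Thm. 3]
[cite: DeligneSerreASENS1974, 6.9–6.11 and §8] -/
theorem exists_ordinary_newform_lift_of_weightOne_of_dvd_level
    (hH : Hida2000_thm326_exists_galoisRep)
    {N₁ : ℕ} [NeZero N₁] (f₁ : CuspForm (Gamma1 N₁) 1)
    (ι₁ : coeffCharField f₁ →+* PadicAlgCl p) (ρ₁ : FramedGaloisRep ℚ (PadicAlgCl p) 2)
    (τ : absoluteGaloisGroup ℚ →* GL (Fin 2) (padicAlgClResidueField p))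
    (hf₁ : IsNewform1 f₁) (hρ₁ : IsGaloisRepOfNewform1 f₁ ι₁ {q | q ∣ N₁} ρ₁)
    (hce : ¬ HasCommonEigenvector τ) (hred : ρ₁.IsReductionOf (RingHom.id _) τ)
    (hpN : p ∣ N₁)
    (hunit : ‖ι₁ ⟨(UpperHalfPlane.qExpansion 1 ⇑f₁).coeff p, cuspCoeff_mem_coeffCharField f₁ p⟩‖ = 1) :
    ∃ (N₀ : ℕ) (_ : NeZero N₀) (k₀ : ℤ) (g : CuspForm (Gamma1 N₀) k₀)
      (ιg : coeffCharField g →+* PadicAlgCl p) (ρg : FramedGaloisRep ℚ (PadicAlgCl p) 2),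
      2 ≤ k₀ ∧ IsNewform1 g ∧
      ‖ιg ⟨(UpperHalfPlane.qExpansion 1 ⇑g).coeff p, cuspCoeff_mem_coeffCharField g p⟩‖ = 1 ∧
      IsGaloisRepOfNewform1 g ιg {q | q ∣ N₀ * p} ρg ∧
      ρg.IsResidualRepOf (RingHom.id _) τ := by
  classical
  have hp : p.Prime := Fact.out
  -- the valuation ring `ℤ̄_p`: membership and maximal ideal through the norm
  have hO : ∀ x : PadicAlgCl p, x ∈ padicAlgClIntegers p ↔ ‖x‖ ≤ 1 :=
    padicAlgCl_mem_valuationSubring_iff p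
  have hOm : ∀ x : padicAlgClIntegers p, x ∈ maximalIdeal (padicAlgClIntegers p) ↔
      ‖(x : PadicAlgCl p)‖ < 1 :=
    mem_maximalIdeal_iff_norm_lt_one hO
  -- ### Step 1: `K_{f₁}` is a number field, the `a_n(f₁)` are integral; `ι ⊇ ι₁`
  have hL := DeligneSerre1974_span_integralLattice1_holds N₁ 1
  haveI : FiniteDimensional ℚ (coeffField f₁) :=
    (IsNewform1.finiteDimensional_coeffField_of_span_integralLattice1 hL) hf₁
  haveI : FiniteDimensional ℚ (coeffCharField f₁) := finiteDimensional_coeffCharField f₁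
  haveI : NumberField (coeffCharField f₁) := NumberField.mk
  obtain ⟨ι, hι⟩ := exists_ringEquiv_padicAlgCl_complex_extends ι₁ (algebraMap (coeffCharField f₁) ℂ)
  have hιsymm : ∀ x : coeffCharField f₁, ι.symm (x : ℂ) = ι₁ x := fun x ↦ by
    apply ι.injective
    rw [RingEquiv.apply_symm_apply, hι x]
    rfl
  have hintZ : ∀ n, IsIntegral ℤ (ι.symm (cuspCoeff f₁ n)) := fun n ↦
    (IsNewform1.isIntegral_cuspCoeff hL le_rfl hf₁ n).map (ι.symm : ℂ →+* PadicAlgCl p).toIntAlgHom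
  have hint : ∀ n, ‖ι.symm (cuspCoeff f₁ n)‖ ≤ 1 := fun n ↦
    (hO _).mp (mem_padicAlgClIntegers_of_isIntegral (hintZ n))
  -- ### Step 3: the data of `exists_ordinary_newform_congr_of_weight_one`
  set χ : DirichletCharacter ℂ N₁ := nebentypus f₁ with hχ
  have hfχ : f₁ ∈ nebentypusSubspace N₁ 1 χ := IsNewform1.mem_nebentypusSubspace_nebentypus_holds hf₁
  have hf1 : cuspCoeff f₁ 1 = 1 := hf₁.2.2.2
  have hT : ∀ (q : ℕ) (hq : q.Prime), ¬ q ∣ N₁ →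
      (haveI : NeZero q := ⟨hq.ne_zero⟩;
        Literature.NumberTheory.EllipticCurves.ModularForms.heckeT (Gamma1 N₁) 1 q f₁) =
        cuspCoeff f₁ q • f₁ := by
    intro q hq _
    haveI : NeZero q := ⟨hq.ne_zero⟩
    exact hf₁.heckeT_apply_eq_cuspCoeff_smul q hq
  -- `U_p f₁ = a_p f₁` with `ι⁻¹ a_p` a unit
  haveI : NeZero p := ⟨hp.ne_zero⟩
  have hnχ := WeightOneOrdinaryLift.norm_dirichletCharacter_le_one ι χ
  have hUf : Literature.NumberTheory.EllipticCurves.ModularForms.heckeT (Gamma1 N₁) 1 p f₁ =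
      cuspCoeff f₁ p • f₁ := hf₁.heckeT_apply_eq_cuspCoeff_smul p hp
  have hα : ‖ι.symm (cuspCoeff f₁ p)‖ = 1 := by
    change ‖ι.symm ((⟨(UpperHalfPlane.qExpansion 1 ⇑f₁).coeff p, cuspCoeff_mem_coeffCharField f₁ p⟩ :
      coeffCharField f₁) : ℂ)‖ = 1
    rw [hιsymm]; exact hunit
  obtain ⟨k, L₀, hL₀0, hL₀, g₀, hk2, -, hg₀, hap, haq, hε⟩ :=
    exists_ordinary_newform_congr_of_weight_one_of_dvd_level ι hpN hfχ hf1 hint hT hUf hα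
  -- ### Step 4: Deligne's representation of `g₀` through `ι⁻¹`, and the residual comparison
  obtain ⟨ρg, hρg, -⟩ := hH g₀ hk2 hg₀ p ι
  set ιg : coeffCharField g₀ →+* PadicAlgCl p :=
    (ι.symm : ℂ →+* PadicAlgCl p).comp (algebraMap (coeffCharField g₀) ℂ) with hιg
  -- norms needed below
  have hnorm_ag : ∀ q : ℕ, q.Prime → ¬ q ∣ N₁ → ‖ι.symm (cuspCoeff g₀ q)‖ ≤ 1 := by
    intro q hq hqL
    have : ι.symm (cuspCoeff g₀ q) = (ι.symm (cuspCoeff g₀ q) - ι.symm (cuspCoeff f₁ q)) +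
        ι.symm (cuspCoeff f₁ q) := by ring
    rw [this]
    exact (PadicAlgCl.isNonarchimedean p _ _).trans (max_le (haq q hq hqL).le (hint q))
  have hnorm_εg : ∀ q : ℕ, q.Prime → ¬ q ∣ N₁ →
      ‖ι.symm (nebentypus g₀ (q : ZMod L₀) * (q : ℂ) ^ (k - 1))‖ ≤ 1 := by
    intro q hq hqL
    have : ι.symm (nebentypus g₀ (q : ZMod L₀) * (q : ℂ) ^ (k - 1)) =
        (ι.symm (nebentypus g₀ (q : ZMod L₀) * (q : ℂ) ^ (k - 1)) - ι.symm (χ q)) + ι.symm (χ q) := by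
      ring
    rw [this]
    exact (PadicAlgCl.isNonarchimedean p _ _).trans (max_le (hε q hq hqL).le (hnχ _).1)
  have hnorm_εf : ∀ q : ℕ, ‖ι.symm ((χ (q : ZMod N₁) : ℂ) * (q : ℂ) ^ ((1 : ℤ) - 1))‖ ≤ 1 := by
    intro q
    rw [sub_self, zpow_zero, mul_one]
    exact (hnχ _).1
  -- the exceptional set `S = {v : ℓ_v ∣ N₁ L₀ p}`
  set S : Set (HeightOneSpectrum (𝓞 ℚ)) :=
    {w | ((primesEquiv w : Nat.Primes) : ℕ) ∣ N₁ * L₀ * p} with hSdef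
  have hM0 : N₁ * L₀ * p ≠ 0 := mul_ne_zero (mul_ne_zero (NeZero.ne N₁) (NeZero.ne L₀)) hp.ne_zero
  have hS : S.Finite := by
    have hdiv : {q : ℕ | q ∣ N₁ * L₀ * p}.Finite :=
      (Nat.divisors (N₁ * L₀ * p)).finite_toSet.subset fun q hq ↦
        (Finset.mem_coe.mpr (Nat.mem_divisors.mpr ⟨hq, hM0⟩))
    refine (hdiv.preimage (f := fun w : HeightOneSpectrum (𝓞 ℚ) ↦ ((primesEquiv w : Nat.Primes) : ℕ))
      (Function.Injective.injOn fun w w' h ↦ ?_)).subset fun w hw ↦ hw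
    exact (primesEquiv (R := 𝓞 ℚ)).injective (Subtype.ext h)
  -- congruent Frobenius characteristic polynomials outside `S`
  have hcong : ∀ w ∉ S, ρ₁.IsUnramifiedAt w ∧ ρg.IsUnramifiedAt w ∧
      ∃ P P' : Polynomial (padicAlgClIntegers p),
        ρ₁.HasFrobCharpolyAt w (P.map (padicAlgClIntegers p).subtype) ∧
        ρg.HasFrobCharpolyAt w (P'.map (padicAlgClIntegers p).subtype) ∧
        P.map (residue (padicAlgClIntegers p)) = P'.map (residue (padicAlgClIntegers p)) := by
    intro w hw
    set q : ℕ := ((primesEquiv w : Nat.Primes) : ℕ) with hqdef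
    have hq : q.Prime := (primesEquiv w).2
    have hwS : ¬ q ∣ N₁ * L₀ * p := hw
    have hqN₁ : ¬ q ∣ N₁ := fun h ↦ hwS ((h.mul_right L₀).mul_right p)
    have hqL₀p : ¬ q ∣ L₀ * p := fun h ↦ hwS (by rw [mul_assoc]; exact dvd_mul_of_dvd_right h N₁)
    obtain ⟨hur₁, hchar₁⟩ := hρ₁ w hqN₁
    obtain ⟨hurg, hcharg⟩ := hρg w hqL₀p
    -- the integral Hecke polynomials
    let c₁ : padicAlgClIntegers p := ⟨ι.symm (cuspCoeff f₁ q), (hO _).mpr (hint q)⟩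
    let c₀ : padicAlgClIntegers p :=
      ⟨ι.symm ((χ (q : ZMod N₁) : ℂ) * (q : ℂ) ^ ((1 : ℤ) - 1)), (hO _).mpr (hnorm_εf q)⟩
    let d₁ : padicAlgClIntegers p := ⟨ι.symm (cuspCoeff g₀ q), (hO _).mpr (hnorm_ag q hq hqN₁)⟩
    let d₀ : padicAlgClIntegers p :=
      ⟨ι.symm (nebentypus g₀ (q : ZMod L₀) * (q : ℂ) ^ (k - 1)), (hO _).mpr (hnorm_εg q hq hqN₁)⟩
    refine ⟨hur₁, hurg, X ^ 2 - C c₁ * X + C c₀, X ^ 2 - C d₁ * X + C d₀, ?_, ?_, ?_⟩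
    · -- `ρ₁`: `(heckePolynomial f₁ q).map ι₁`
      have e : (X ^ 2 - C c₁ * X + C c₀ : Polynomial (padicAlgClIntegers p)).map
          (padicAlgClIntegers p).subtype =
          (Literature.NumberTheory.EllipticCurves.ModularForms.heckePolynomial f₁ q).map ι₁ := by
        simp only [Literature.NumberTheory.EllipticCurves.ModularForms.heckePolynomial,
          Polynomial.map_add, Polynomial.map_sub, Polynomial.map_mul, Polynomial.map_pow, map_X,
          map_C, ← hιsymm]
        rfl
      rw [e]
      exact hchar₁
    · -- `ρg`: `(heckePolynomial g₀ q).map ιg`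
      have e : (X ^ 2 - C d₁ * X + C d₀ : Polynomial (padicAlgClIntegers p)).map
          (padicAlgClIntegers p).subtype =
          (Literature.NumberTheory.EllipticCurves.ModularForms.heckePolynomial g₀ q).map ιg := by
        simp only [Literature.NumberTheory.EllipticCurves.ModularForms.heckePolynomial,
          Polynomial.map_add, Polynomial.map_sub, Polynomial.map_mul, Polynomial.map_pow, map_X,
          map_C, hιg, RingHom.comp_apply]
        rfl
      rw [e]
      exact hcharg
    · -- the reductions agree
      have h₁ : residue (padicAlgClIntegers p) c₁ = residue (padicAlgClIntegers p) d₁ := by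
        rw [← sub_eq_zero, ← map_sub, IsLocalRing.residue_eq_zero_iff, hOm]
        change ‖ι.symm (cuspCoeff f₁ q) - ι.symm (cuspCoeff g₀ q)‖ < 1
        rw [← norm_neg, neg_sub]
        exact haq q hq hqN₁
      have h₀ : residue (padicAlgClIntegers p) c₀ = residue (padicAlgClIntegers p) d₀ := by
        rw [← sub_eq_zero, ← map_sub, IsLocalRing.residue_eq_zero_iff, hOm]
        change ‖ι.symm ((χ (q : ZMod N₁) : ℂ) * (q : ℂ) ^ ((1 : ℤ) - 1)) -
          ι.symm (nebentypus g₀ (q : ZMod L₀) * (q : ℂ) ^ (k - 1))‖ < 1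
        rw [sub_self, zpow_zero, mul_one, ← norm_neg, neg_sub]
        exact hε q hq hqN₁
      simp only [Polynomial.map_add, Polynomial.map_sub, Polynomial.map_mul, Polynomial.map_pow,
        map_X, map_C, h₁, h₀]
  -- residual representations: `τ` of `ρ₁` (irreducible reduction), some `τ'` of `ρg`
  have hirrτ : (glRepresentation τ).IsIrreducible :=
    (isIrreducible_iff_not_hasCommonEigenvector τ).2 hce
  have hτ : ρ₁.IsResidualRepOf (RingHom.id _) τ := hred.isResidualRepOf_of_isIrreducible hirrτ
  obtain ⟨τ', hτ'⟩ := ρg.exists_isResidualRepOf_fin_two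
  have hres : ρg.IsResidualRepOf (RingHom.id _) τ :=
    ρ₁.isResidualRepOf_of_isResidualRepOf_of_congruent ρg hS hcong hτ hτ'
  -- ### Conclusion
  refine ⟨L₀, hL₀0, k, g₀, ιg, ρg, hk2, hg₀, ?_, hρg, hres⟩
  change ‖ι.symm (algebraMap (coeffCharField g₀) ℂ ⟨(UpperHalfPlane.qExpansion 1 ⇑g₀).coeff p,
    cuspCoeff_mem_coeffCharField g₀ p⟩)‖ = 1
  exact WeightOneOrdinaryLift.norm_eq_one_of_norm_sub_lt_one hα hap

end Main

end Literature.NumberTheory.Automorphic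

end
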